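/-
Copyright (c) 2026 the pub-hodgecm-mathlib formalisation cell (harness21).  Prover seat hodgecm-mathlib-K2Liu-p10 (g4), Track B «K2-LIT»,
#184♮ = hLiu418 = `stmt-HodgeConjecture-24832`; (σ) endgame organ, SMALL SIDE, σ-2: THE FRAME `θ_v` AND THE SECTION `B` OF THE CM INSTANCE (definition lane).
-/
import Summits.HodgeConjecture.HodgeConjecture.Theorems.K2LiuKRSectionDefs                    -- ★ S-2b (`krSection`, `krSection_mul`)
import Summits.HodgeConjecture.HodgeConjecture.Theorems.K2LiuKRFrameDefs                      -- ★ S-0a (`krFrameTw`)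
import Summits.HodgeConjecture.HodgeConjecture.Theorems.K2LiuSchrodingerSwapWeylImplementer     -- ★ `isUnit_det_deltaGramLoc` (brings β-1 `deltaGramLoc`)
import Literature.NumberTheory.K2Lit.DoubledTensorEmbedding                                   -- ★ `epsV`
import Literature.NumberTheory.GelbartRogawski1991.UnitaryDualPairThetaKernelCM                 -- ★ `imagUnit` letters
import HarnessLib

/-!
# Crux `HLiu418`, (σ) small side, σ-2: THE KUDLA–RALLIS FRAME `θ_v` OF THE CM INSTANCE AND ITS SECTION `B := krSection θ_v μ ω`

Cell `hodgecm-mathlib`, crux item hLiu418 = `stmt-HodgeConjecture-24832`, route of record `HCCMUnconditional`; squad K2 ∕ K2Liu, prover K2Liu-p10 (g4).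
DEFINITIONS WITH BODIES + theorems; no instance, no notation, no named fact, no `sorry`; definition lane, `--supports stmt-HodgeConjecture-24832 --as helper`.
CM currency `(L) (e dV hdV hdV0 dW hdW hdW0) (eW e') (v)`; the Witt frame `P` BY VALUE (★ p07 `K2LiuWittFrameLocalRing.exists_wittFrame_localRing` supplies it at a non-split `v`).

* §1 **`twistLoc`** — the killed-block twist `A₀ := (J_{Δ,v}(𝔻))ᵀ` as a linear automorphism of `L⁺_v^{n+n}` (invertible by ★ `isUnit_det_deltaGramLoc`), `twistLoc_apply`;
* §2 **`thetaLoc P : L⁺_v^{n′+n′} ≃ₜ ((L⁺_v^{n+n} ⊕ L⁺_v^{n+n}) ⊕ L⁺_v^{n+n})`** := ★ `krFrameTw (epsV e eW e′) P twistLoc` (kept `a′`, killed `Y′` twisted by `A₀`, integrated `X′`), `thetaLoc_add`;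
* §3 **`sectionB P μ ω := krSection (thetaLoc P) μ ω`** (★ S-2b) and V8e's **`hB`** for any multiplicative `ω` (**`sectionB_mul`**) — at the instance `ω u := toRep (localSchrodingerDelta big) (sΔB u)`.
The letters of `sectionB` — `hSiegS` (★ σ-5 fold `isLocalSiegelSection_of_levi_unip_hom` + ★ `krSection_levi_mul`∕`_unip_mul` + ★ `hS0` + ★ Jacobian + ★ (L3-a) + ★ `hq0`) — are assembled in
I-4b by K2Liu-p09 (g6) with his `ω`, `sΔB`, `M_Δ` names.

HONEST LABEL: HC_CM is proved only modulo the 7 printed citations (2 remaining named inputs: hLiu418 = stmt-HodgeConjecture-24832, h413 = stmt-HodgeConjecture-24833)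
until rung 0 closes; this file defines carriers and closes no item.
References: [KudlaRallis1994] §1; [Kudla1994] §3; [HarrisKudlaSweet1996] §4.
-/

set_option autoImplicit false
set_option linter.dupNamespace false -- the mandated namespace repeats `HodgeConjecture.HodgeConjecture`

noncomputable section

open scoped Matrix
open NumberField IsDedekindDomain MeasureTheory
open Literature.NumberTheory.Automorphic Literature.NumberTheory.Automorphic.UnitaryGroup
open Literature.NumberTheory.GelbartRogawski1991 Literature.NumberTheory.GelbartRogawski1991.GRConstruction
open Literature.NumberTheory.GelbartRogawski1991.UnitaryDualPair
open Literature.NumberTheory.K2Lit.SiegelDoubled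
open Summit.HodgeConjecture.HodgeConjecture.Cruxes.HLiu418.K2LiuDoublingSchrodingerModelDefs
open Summit.HodgeConjecture.HodgeConjecture.Cruxes.HLiu418.K2LiuSchrodingerSwapWeylImplementer
open Summit.HodgeConjecture.HodgeConjecture.Cruxes.HLiu418.K2LiuKRFrameDefs
open Summit.HodgeConjecture.HodgeConjecture.Cruxes.HLiu418.K2LiuKRSectionDefs

namespace Summit.HodgeConjecture.HodgeConjecture.Cruxes.HLiu418.K2LiuKRFrameInstanceDefs

variable (L : Type) [Field L] [NumberField L] [IsCMField L] [Algebra.IsQuadraticExtension (Fp L) L]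
variable {N M n : ℕ} (e : Fin N × Fin M ≃ Fin n)
  (dV : Fin N → L) (hdV : ∀ i, IsCMField.complexConj L (dV i) = dV i) (hdV0 : ∀ i, dV i ≠ 0)
  (dW : Fin M → L) (hdW : ∀ i, IsCMField.complexConj L (dW i) = dW i) (hdW0 : ∀ i, dW i ≠ 0)
variable {M' n' : ℕ} (eW : Fin M × Fin 3 ≃ Fin M') (e' : Fin N × Fin M' ≃ Fin n')
  (v : HeightOneSpectrum (𝓞 (Fp L)))

/-! ## §1 The killed-block twist `A₀ = J_Δ(𝔻)ᵀ` -/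

/-- **`twistLoc : L⁺_v^{n+n} ≃ₗ L⁺_v^{n+n}`, `z ↦ J_{Δ,v}(𝔻)ᵀ z`** (invertible: ★ `isUnit_det_deltaGramLoc`). [cite: KudlaRallis1994, §1] -/
def twistLoc : (Fin (n + n) → v.adicCompletion (Fp L)) ≃ₗ[v.adicCompletion (Fp L)] (Fin (n + n) → v.adicCompletion (Fp L)) :=
  Matrix.toLinearEquiv' (deltaGramLoc L e dV hdV dW hdW v)ᵀ
    (Matrix.invertibleOfIsUnitDet _ (by rw [Matrix.det_transpose]; exact isUnit_det_deltaGramLoc L e dV hdV hdV0 dW hdW hdW0 v))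

omit [Algebra.IsQuadraticExtension (Fp L) L] in
/-- unfolding: `twistLoc z = J_Δᵀ z` (the `hA` of ★ `slice_letter`). [cite: KudlaRallis1994, §1] -/
theorem twistLoc_apply (z : Fin (n + n) → v.adicCompletion (Fp L)) :
    twistLoc L e dV hdV hdV0 dW hdW hdW0 v z = (deltaGramLoc L e dV hdV dW hdW v)ᵀ *ᵥ z := by
  rw [twistLoc, ← LinearEquiv.coe_coe, Matrix.toLinearEquiv'_apply, Matrix.toLin'_apply]

/-! ## §2 The frame `θ_v` -/

/-- **THE KUDLA–RALLIS FRAME OF THE CM INSTANCE `θ_v := krFrameTw (epsV e eW e′) P A₀`** along a Witt frame `P` of `V′_v` BY VALUE. [cite: KudlaRallis1994, §1] [cite: Kudla1994, §3] -/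
def thetaLoc (P : GL (Fin 3) (LocalRing L v)) :
    (Fin (n' + n') → v.adicCompletion (Fp L)) ≃ₜ ((Fin (n + n) ⊕ Fin (n + n)) ⊕ Fin (n + n) → v.adicCompletion (Fp L)) :=
  krFrameTw (Fp L) L (IsCMField.complexConj L) (complexConj_imagUnit L) (imagUnit_ne_zero L) v n (epsV e eW e') P (twistLoc L e dV hdV hdV0 dW hdW hdW0 v)

/-- unfolding. [cite: KudlaRallis1994, §1] -/
theorem thetaLoc_eq (P : GL (Fin 3) (LocalRing L v)) :
    thetaLoc L e dV hdV hdV0 dW hdW hdW0 eW e' v P =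
      krFrameTw (Fp L) L (IsCMField.complexConj L) (complexConj_imagUnit L) (imagUnit_ne_zero L) v n (epsV e eW e') P (twistLoc L e dV hdV hdV0 dW hdW hdW0 v) :=
  rfl

/-- `θ_v` is additive (the `hθ` of ★ `isAddHaarMeasure_map_frame`). [cite: KudlaRallis1994, §1] -/
theorem thetaLoc_add (P : GL (Fin 3) (LocalRing L v)) (x y : Fin (n' + n') → v.adicCompletion (Fp L)) :
    thetaLoc L e dV hdV hdV0 dW hdW hdW0 eW e' v P (x + y) = thetaLoc L e dV hdV hdV0 dW hdW hdW0 eW e' v P x + thetaLoc L e dV hdV hdV0 dW hdW hdW0 eW e' v P y :=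
  krFrameTw_add _ _ _ _ _ _ _ _ _ _ x y

/-! ## §3 The section `B` -/

section B

variable [MeasurableSpace (v.adicCompletion (Fp L))] [BorelSpace (v.adicCompletion (Fp L))] [SecondCountableTopology (v.adicCompletion (Fp L))]

/-- **THE SMALL-SIDE SECTION OF V8e `B := krSection θ_v μ ω`**, `B Φ h = (r_v(ω(h)Φ))(0)`. [cite: KudlaRallis1994, §1] [cite: HarrisKudlaSweet1996, §4] -/
def sectionB (P : GL (Fin 3) (LocalRing L v)) (μ : Measure (Fin (n + n) → v.adicCompletion (Fp L))) [μ.IsAddHaarMeasure] {H : Type*}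
    (ω : H → SchwartzBruhat (Fin (n' + n') → v.adicCompletion (Fp L)) →ₗ[ℂ] SchwartzBruhat (Fin (n' + n') → v.adicCompletion (Fp L))) :
    SchwartzBruhat (Fin (n' + n') → v.adicCompletion (Fp L)) →ₗ[ℂ] (H → ℂ) :=
  krSection (thetaLoc L e dV hdV hdV0 dW hdW hdW0 eW e' v P) μ ω

/-- unfolding. [cite: KudlaRallis1994, §1] -/
theorem sectionB_eq (P : GL (Fin 3) (LocalRing L v)) (μ : Measure (Fin (n + n) → v.adicCompletion (Fp L))) [μ.IsAddHaarMeasure] {H : Type*}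
    (ω : H → SchwartzBruhat (Fin (n' + n') → v.adicCompletion (Fp L)) →ₗ[ℂ] SchwartzBruhat (Fin (n' + n') → v.adicCompletion (Fp L))) :
    sectionB L e dV hdV hdV0 dW hdW hdW0 eW e' v P μ ω = krSection (thetaLoc L e dV hdV hdV0 dW hdW hdW0 eW e' v P) μ ω :=
  rfl

/-- **V8e's `hB`**: `B (ω u Φ) h = B Φ (h u)` for multiplicative `ω` (at the instance `ω := toRep ∘ sΔB`, a hom). [cite: HarrisKudlaSweet1996, §4] -/
theorem sectionB_mul (P : GL (Fin 3) (LocalRing L v)) (μ : Measure (Fin (n + n) → v.adicCompletion (Fp L))) [μ.IsAddHaarMeasure] {H : Type*} [Mul H]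
    (ω : H → SchwartzBruhat (Fin (n' + n') → v.adicCompletion (Fp L)) →ₗ[ℂ] SchwartzBruhat (Fin (n' + n') → v.adicCompletion (Fp L)))
    (hω : ∀ (h u : H) (Φ : SchwartzBruhat (Fin (n' + n') → v.adicCompletion (Fp L))), ω (h * u) Φ = ω h (ω u Φ))
    (u : H) (Φ : SchwartzBruhat (Fin (n' + n') → v.adicCompletion (Fp L))) (h : H) :
    sectionB L e dV hdV hdV0 dW hdW hdW0 eW e' v P μ ω (ω u Φ) h = sectionB L e dV hdV hdV0 dW hdW hdW0 eW e' v P μ ω Φ (h * u) :=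
  krSection_mul _ μ ω hω u Φ h

end B

end Summit.HodgeConjecture.HodgeConjecture.Cruxes.HLiu418.K2LiuKRFrameInstanceDefs

end
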